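import Literature.MeasureTheory.Hausdorff.EnergyContent
import Literature.Probability.Moments.PaleyZygmund
import Mathlib.MeasureTheory.Measure.Prod
import Mathlib.MeasureTheory.Integral.Lebesgue.Countable
import HarnessLib

/-!
# The second moment method for the Hausdorff dimension of random limit sets (Beffara's Proposition 1 (2))

Topic: probability / random fractals. V. Beffara, *The dimension of the SLE curves*, Ann. Probab.
36 (2008), §1, recalls from *Hausdorff dimensions for SLE₆*, Ann. Probab. 32 (2004), §1.2 (with
a detailed proof in Beffara, Ann. Inst. Fourier 53 (2003), Thm. 2, the continuous version of
Lawler's lemma, G. F. Lawler, Bolyai Soc. Math. Stud. 9 (1999)) the following: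

> Let `λ` be the Lebesgue measure in `[0,1]^d` and `(C_ε)_{ε>0}` a family of random Borel subsets
> of `[0,1]^d` with `C_ε ⊆ C_{ε'}` a.s. for `ε < ε'`, `C = ⋂ C_ε`, `s ≥ 0`. Conditions:
> 1. `P(x ∈ C_ε) ≍ ε^s` for all `x`; 2. `P(λ(C_ε ∩ B(x, ε)) > c ε^d | x ∈ C_ε) ≥ c > 0`;
> 3. `P({x, y} ⊆ C_ε) ≤ c ε^{2s} |x - y|^{-s}`.
> **Proposition 1.** (1) If 1 and 2 hold, then a.s. `dim_H(C) ≤ d - s`; (2) if 1 and 3 hold,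
> then with positive probability `dim_H(C) ≥ d - s`.

This file **proves part (2)** (`exists_measurableSet_le_dimH_iInter`, `measure_le_dimH_iInter_pos`)
in an abstract form which isolates what the proof uses: a compact set `K` of a metric space
`X` (the unit square of `ℂ`) with a finite reference measure `λ ≠ 0` carried by `K` whose Riesz
energies `I_β(λ) = ∫∫ d(x,y)^{-β} dλ dλ` are finite for `0 < β < d` (this is where `d` enters;
for the Lebesgue measure of the unit square `d = 2`), a sequence of jointly measurable random
sets `Cₙ ⊆ Ω × X` (the `C_{εₙ}` along any sequence `εₙ → 0`) whose sections are a.s. closed,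
contained in `K` and decreasing, scales `pₙ ∈ (0, ∞)` (`= εₙ^s`), the lower half of
condition 1 (`P(x ∈ Cₙ) ≥ c₁ pₙ`) and condition 3 (`P(x, y ∈ Cₙ) ≤ c₃ pₙ² d(x, y)^{-s}`), and
the conclusion `P(dim_H ⋂ₙ Cₙ ≥ d - s) > 0`. Closedness of the sections (true in the
applications, where `C_ε` is a finite union of closed boxes or a closed neighbourhood of a
closed random set) is what makes the passage from `Cₙ` to `⋂ Cₙ` work without constructing a
limiting Frostman measure: a lower bound on the `α`-ball content of all `Cₙ` passes to the
compact decreasing intersection (`le_ballContent_iInter`). Part (1) (first moment and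
Borel–Cantelli) is not treated here.

## The proof

With `μₙ(ω) = pₙ⁻¹ λ|_{Cₙ(ω)}`: Tonelli (`le_lintegral_mass`, `lintegral_mass_sq_le`,
`lintegral_rieszEnergy_le`) gives `E μₙ(X) ≥ c₁ λ(X) =: 2a`, `E μₙ(X)² ≤ c₃ I_s(λ)` and
`E I_α(μₙ) ≤ c₃ I_{α+s}(λ)`. Paley–Zygmund (`Literature.Probability.Moments.paleyZygmund_div_le`)
gives `P(μₙ(X) > a) ≥ q₀ := a²/(c₃ I_s(λ)) ∧ 1`, Markov gives `P(I_α(μₙ) ≥ L_α) ≤ q₀/2` for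
`L_α = 2(c₃ I_{α+s}(λ) + 1)/q₀`, so the event `Goodₙ(α) = {μₙ(X) > a, I_α(μₙ) < L_α}` has
probability `≥ q₀/2`, and on it every cover of `Cₙ` by balls has `∑ rᵢ^α ≥ c_α > 0`
(`Literature.MeasureTheory.Hausdorff.le_ballContent_of_rieszEnergy_le`, `c_α` deterministic). On
`limsupₙ Goodₙ(α)` (probability `≥ q₀/2`, `le_measure_limsup`) and the a.s. regularity event,
monotonicity gives the content bound for all `n`, compactness passes it to `⋂ Cₙ`, whence
`dim_H ⋂ Cₙ ≥ α`; finally `α_k ↑ d - s` through `limsup_k` of these events.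

## Mathlib

We USE `Measure.prod_apply`, `Measure.prod_apply_symm`, `lintegral_prod`,
`lintegral_lintegral_swap`, `Measurable.lintegral_prod_right'`, `measurable_measure_prodMk_left`,
`meas_ge_le_lintegral_div`, `tendsto_measure_iInter_atTop`, `exists_measurable_superset_of_null`,
`measure_inter_conull`. Mathlib has no random-fractal dimension lemmas (searched `dimH`,
`Frostman`, `second moment`).

## References

* V. Beffara, *The dimension of the SLE curves*, Ann. Probab. 36 (2008) 1421–1452, Prop. 1.
* V. Beffara, *Hausdorff dimensions for SLE₆*, Ann. Probab. 32 (2004) 2606–2629, §1.2, Prop. 1.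
* V. Beffara, *On conformally invariant subsets of the planar Brownian curve*, Ann. Inst.
  Fourier 53 (2003) 455–475, Thm. 2.
* G. F. Lawler, *Geometric and fractal properties of Brownian motion and random walk paths in
  two and three dimensions*, Bolyai Soc. Math. Stud. 9 (1999) 219–258.
-/

noncomputable section

open Set Filter Function Metric
open _root_.MeasureTheory _root_.MeasureTheory.Measure _root_.Topology
open Literature.MeasureTheory.Hausdorff Literature.Probability.Moments
open scoped ENNReal NNReal Topology

namespace Literature.Probability.RandomFractals

variable {Ω : Type*} {mΩ : MeasurableSpace Ω} {P : Measure Ω}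
/-! ### Tonelli for random sets: pair functionals of the sections -/

section Tonelli

variable {X : Type*} [MeasurableSpace X] {lam : Measure X} [SFinite lam]

/-- The **pair event** `{ω | (ω, x) ∈ C ∧ (ω, y) ∈ C}` of a random set `C ⊆ Ω × X`. [folklore] -/
def pairSet (C : Set (Ω × X)) (x y : X) : Set Ω :=
  {ω | (ω, x) ∈ C ∧ (ω, y) ∈ C}

/-- The pair event is measurable. [folklore] -/
theorem measurableSet_pairSet {C : Set (Ω × X)} (hC : MeasurableSet C) (x y : X) :
    MeasurableSet (pairSet C x y) :=
  (hC.preimage (measurable_id.prodMk measurable_const)).inter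
    (hC.preimage (measurable_id.prodMk measurable_const))

/-- The weighted pair integrand `G(ω, (x, y)) = 1_C(ω, x) 1_C(ω, y) w(x, y)` on `Ω × (X × X)`.
[folklore] -/
def pairIntegrand (C : Set (Ω × X)) (w : X × X → ℝ≥0∞) (r : Ω × (X × X)) : ℝ≥0∞ :=
  C.indicator 1 (r.1, r.2.1) * (C.indicator 1 (r.1, r.2.2) * w r.2)

/-- The pair integrand is jointly measurable. [folklore] -/
theorem measurable_pairIntegrand {C : Set (Ω × X)} (hC : MeasurableSet C) {w : X × X → ℝ≥0∞}
    (hw : Measurable w) : Measurable (pairIntegrand C w) := by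
  unfold pairIntegrand
  refine Measurable.mul ?_ (Measurable.mul ?_ (hw.comp measurable_snd))
  · exact (measurable_one.indicator hC).comp (measurable_fst.prodMk (measurable_fst.comp measurable_snd))
  · exact (measurable_one.indicator hC).comp (measurable_fst.prodMk (measurable_snd.comp measurable_snd))

omit [MeasurableSpace X] in
/-- Pointwise: the pair integrand is `w(x, y)` on the pair event and `0` off it. [folklore] -/
theorem pairIntegrand_eq_indicator (C : Set (Ω × X)) (w : X × X → ℝ≥0∞) (ω : Ω) (q : X × X) :
    pairIntegrand C w (ω, q) = (pairSet C q.1 q.2).indicator (fun _ ↦ w q) ω := by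
  unfold pairIntegrand pairSet
  by_cases h1 : (ω, q.1) ∈ C <;> by_cases h2 : (ω, q.2) ∈ C <;> simp [indicator, h1, h2]

/-- **The double section integral as a product integral**:
`∫_{C_ω} ∫_{C_ω} w dλ dλ = ∫ G(ω, ·) d(λ ⊗ λ)`. [folklore] -/
theorem setLIntegral_setLIntegral_section_eq {C : Set (Ω × X)} (hC : MeasurableSet C)
    {w : X × X → ℝ≥0∞} (hw : Measurable w) (ω : Ω) :
    ∫⁻ x in Prod.mk ω ⁻¹' C, ∫⁻ y in Prod.mk ω ⁻¹' C, w (x, y) ∂lam ∂lam =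
      ∫⁻ q, pairIntegrand C w (ω, q) ∂(lam.prod lam) := by
  have hA : MeasurableSet (Prod.mk ω ⁻¹' C) := measurable_prodMk_left hC
  have hGω : Measurable fun q : X × X ↦ pairIntegrand C w (ω, q) :=
    (measurable_pairIntegrand hC hw).comp measurable_prodMk_left
  rw [lintegral_prod _ hGω.aemeasurable]
  -- outer indicator
  rw [← lintegral_indicator hA]
  refine lintegral_congr fun x ↦ ?_
  by_cases hx : x ∈ Prod.mk ω ⁻¹' C
  · rw [indicator_of_mem hx, ← lintegral_indicator hA]
    refine lintegral_congr fun y ↦ ?_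
    by_cases hy : y ∈ Prod.mk ω ⁻¹' C
    · rw [indicator_of_mem hy]
      simp [pairIntegrand, indicator_of_mem (mem_preimage.1 hx), indicator_of_mem (mem_preimage.1 hy)]
    · rw [indicator_of_notMem hy]
      simp [pairIntegrand, indicator_of_notMem (show (ω, y) ∉ C from hy)]
  · rw [indicator_of_notMem hx]
    have h0 : ∀ y, pairIntegrand C w (ω, (x, y)) = 0 := fun y ↦ by
      simp [pairIntegrand, indicator_of_notMem (show (ω, x) ∉ C from hx)]
    simp [h0]

/-- The double section integral is a measurable function of `ω`. [folklore] -/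
theorem measurable_setLIntegral_setLIntegral_section {C : Set (Ω × X)}
    (hC : MeasurableSet C) {w : X × X → ℝ≥0∞} (hw : Measurable w) :
    Measurable fun ω ↦ ∫⁻ x in Prod.mk ω ⁻¹' C, ∫⁻ y in Prod.mk ω ⁻¹' C, w (x, y) ∂lam ∂lam := by
  simp_rw [setLIntegral_setLIntegral_section_eq hC hw]
  exact (measurable_pairIntegrand hC hw).lintegral_prod_right'

/-- **Tonelli for the pair functional**: the expectation of `∫_{C_ω} ∫_{C_ω} w` is
`∫∫ w(x, y) P(x, y ∈ C) dλ dλ`. [folklore] -/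
theorem lintegral_setLIntegral_setLIntegral_section [SFinite P] {C : Set (Ω × X)}
    (hC : MeasurableSet C) {w : X × X → ℝ≥0∞} (hw : Measurable w) :
    ∫⁻ ω, ∫⁻ x in Prod.mk ω ⁻¹' C, ∫⁻ y in Prod.mk ω ⁻¹' C, w (x, y) ∂lam ∂lam ∂P =
      ∫⁻ q, w q * P (pairSet C q.1 q.2) ∂(lam.prod lam) := by
  simp_rw [setLIntegral_setLIntegral_section_eq hC hw]
  rw [lintegral_lintegral_swap (f := fun ω (q : X × X) ↦ pairIntegrand C w (ω, q))
    (by exact (measurable_pairIntegrand hC hw).aemeasurable)]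
  refine lintegral_congr fun q ↦ ?_
  simp_rw [pairIntegrand_eq_indicator]
  rw [lintegral_indicator_const (measurableSet_pairSet hC q.1 q.2)]

end Tonelli

variable {X : Type*} [MetricSpace X] [MeasurableSpace X] [BorelSpace X] [SecondCountableTopology X]

/-! ### Riesz kernels and energies: algebra -/

omit [MeasurableSpace X] [BorelSpace X] [SecondCountableTopology X] in
/-- `k_a · k_b = k_{a+b}` for the Riesz kernels (`a, b ≥ 0`). [folklore] -/
theorem rieszKernel_mul_rieszKernel {a b : ℝ} (ha : 0 ≤ a) (hb : 0 ≤ b) (x y : X) :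
    rieszKernel a x y * rieszKernel b x y = rieszKernel (a + b) x y := by
  simp only [rieszKernel]
  rw [ENNReal.rpow_add_of_nonneg _ _ ha hb]

/-- The energy as an integral over `X × X`. [folklore] -/
theorem rieszEnergy_eq_lintegral_prod (β : ℝ) (μ : Measure X) [SFinite μ] :
    rieszEnergy β μ = ∫⁻ q : X × X, rieszKernel β q.1 q.2 ∂(μ.prod μ) := by
  rw [rieszEnergy, lintegral_prod _ (measurable_rieszKernel_uncurry β).aemeasurable]
  rfl

omit [BorelSpace X] [SecondCountableTopology X] in
/-- The `0`-energy is the squared mass. [folklore] -/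
theorem rieszEnergy_zero (μ : Measure X) : rieszEnergy 0 μ = μ univ * μ univ := by
  simp [rieszEnergy, rieszPotential, rieszKernel, lintegral_const]

/-- The energy of `c • μ|_A` is `c² ∫_A ∫_A k`. [folklore] -/
theorem rieszEnergy_smul_restrict (β : ℝ) (μ : Measure X) [SFinite μ] (c : ℝ≥0∞) (A : Set X) :
    rieszEnergy β (c • μ.restrict A) = c * c * ∫⁻ x in A, ∫⁻ y in A, rieszKernel β x y ∂μ ∂μ := by
  simp only [rieszEnergy, rieszPotential, lintegral_smul_measure, smul_eq_mul]
  rw [lintegral_const_mul _ ?_, mul_assoc]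
  exact (measurable_rieszKernel_uncurry β).lintegral_prod_right' (ν := μ.restrict A)





/-! ### Reference measures carried by a set -/

omit [MetricSpace X] [BorelSpace X] [SecondCountableTopology X] in
/-- If `λ(Kᶜ) = 0` then `λ ⊗ λ`-a.e. both coordinates lie in `K` (both projections are
quasi-measure-preserving). [folklore] -/
theorem ae_prod_mem_mem {lam : Measure X} [SFinite lam] {K : Set X} (hlamK : lam Kᶜ = 0) :
    ∀ᵐ q ∂(lam.prod lam), q.1 ∈ K ∧ q.2 ∈ K := by
  have hK : ∀ᵐ x ∂lam, x ∈ K := by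
    rw [ae_iff]
    exact hlamK
  filter_upwards [quasiMeasurePreserving_fst.ae hK, quasiMeasurePreserving_snd.ae hK] with q h1 h2
  exact ⟨h1, h2⟩

/-! ### Moments of the random measures `μ_ω = p⁻¹ · λ|_{C_ω}` -/

section Moments

variable [SFinite P] {lam : Measure X} [SFinite lam] {C : Set (Ω × X)}

omit [MetricSpace X] [BorelSpace X] [SecondCountableTopology X] in
/-- **First moment**: under condition 1 (`P(x ∈ C) ≥ c₁ p` for all `x`), the expected mass of
`μ_ω = p⁻¹ λ|_{C_ω}` is at least `c₁ λ(X)` (Tonelli). [folklore] -/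
theorem le_lintegral_mass (hC : MeasurableSet C) {K : Set X} (hK : MeasurableSet K)
    (hlamK : lam Kᶜ = 0) {p c₁ : ℝ≥0∞} (hp0 : p ≠ 0) (hpt : p ≠ ⊤)
    (h1 : ∀ x ∈ K, c₁ * p ≤ P {ω | (ω, x) ∈ C}) :
    c₁ * lam univ ≤ ∫⁻ ω, p⁻¹ * lam (Prod.mk ω ⁻¹' C) ∂P := by
  rw [lintegral_const_mul _ (measurable_measure_prodMk_left hC), ← Measure.prod_apply hC,
    Measure.prod_apply_symm hC]
  have hKu : lam K = lam univ := by
    apply le_antisymm (measure_mono (subset_univ K))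
    calc lam univ ≤ lam K + lam Kᶜ := measure_univ_le_add_compl K
      _ = lam K := by rw [hlamK, add_zero]
  calc c₁ * lam univ = p⁻¹ * ∫⁻ _ in K, c₁ * p ∂lam := by
        rw [setLIntegral_const, hKu, ← mul_assoc, ← mul_assoc, mul_comm p⁻¹ c₁, mul_assoc c₁,
          ENNReal.inv_mul_cancel hp0 hpt, mul_one]
    _ ≤ p⁻¹ * ∫⁻ y in K, P ((fun ω ↦ (ω, y)) ⁻¹' C) ∂lam := by
        gcongr p⁻¹ * ?_
        exact setLIntegral_mono' hK fun y hy ↦ h1 y hy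
    _ ≤ p⁻¹ * ∫⁻ y, P ((fun ω ↦ (ω, y)) ⁻¹' C) ∂lam :=
        mul_le_mul' le_rfl (setLIntegral_le_lintegral _ _)

/-- **Second moment**: under condition 3 (`P(x, y ∈ C) ≤ c₃ p² k_s(x, y)`), the second moment of
the mass of `μ_ω` is at most `c₃ I_s(λ)` (Tonelli). [folklore] -/
theorem lintegral_mass_sq_le (hC : MeasurableSet C) {K : Set X} (hlamK : lam Kᶜ = 0)
    {p c₃ : ℝ≥0∞} (hp0 : p ≠ 0) (hpt : p ≠ ⊤) {s : ℝ}
    (h3 : ∀ x ∈ K, ∀ y ∈ K, P (pairSet C x y) ≤ c₃ * p ^ 2 * rieszKernel s x y) :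
    ∫⁻ ω, (p⁻¹ * lam (Prod.mk ω ⁻¹' C)) ^ 2 ∂P ≤ c₃ * rieszEnergy s lam := by
  have hsq : ∀ ω, (p⁻¹ * lam (Prod.mk ω ⁻¹' C)) ^ 2 =
      p⁻¹ ^ 2 * ∫⁻ _ in Prod.mk ω ⁻¹' C, ∫⁻ _ in Prod.mk ω ⁻¹' C, (1 : ℝ≥0∞) ∂lam ∂lam := by
    intro ω
    rw [mul_pow, setLIntegral_const, setLIntegral_const, one_mul, sq (lam (Prod.mk ω ⁻¹' C))]
  simp_rw [hsq]
  rw [lintegral_const_mul _ (measurable_setLIntegral_setLIntegral_section hC measurable_const),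
    lintegral_setLIntegral_setLIntegral_section hC measurable_const]
  calc p⁻¹ ^ 2 * ∫⁻ q, (fun _ ↦ (1 : ℝ≥0∞)) q * P (pairSet C q.1 q.2) ∂(lam.prod lam)
      ≤ p⁻¹ ^ 2 * ∫⁻ q, c₃ * p ^ 2 * rieszKernel s q.1 q.2 ∂(lam.prod lam) := by
        gcongr p⁻¹ ^ 2 * ?_
        refine lintegral_mono_ae ?_
        filter_upwards [ae_prod_mem_mem hlamK] with q hq
        simp only [one_mul]
        exact h3 q.1 hq.1 q.2 hq.2
    _ = c₃ * rieszEnergy s lam := by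
        rw [lintegral_const_mul _ (measurable_rieszKernel_uncurry s), rieszEnergy_eq_lintegral_prod,
          ← mul_assoc, ← mul_assoc, mul_comm (p⁻¹ ^ 2) c₃, mul_assoc c₃, ← ENNReal.inv_pow,
          ENNReal.inv_mul_cancel (pow_ne_zero 2 hp0) (ENNReal.pow_ne_top hpt), mul_one]

/-- **Expected energy**: under condition 3, `E[I_α(μ_ω)] ≤ c₃ I_{α+s}(λ)` (`α, s ≥ 0`; Tonelli and
`k_α k_s = k_{α+s}`). [folklore] -/
theorem lintegral_rieszEnergy_le (hC : MeasurableSet C) {K : Set X} (hlamK : lam Kᶜ = 0)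
    {p c₃ : ℝ≥0∞} (hp0 : p ≠ 0) (hpt : p ≠ ⊤) {s α : ℝ} (hs : 0 ≤ s) (hα : 0 ≤ α)
    (h3 : ∀ x ∈ K, ∀ y ∈ K, P (pairSet C x y) ≤ c₃ * p ^ 2 * rieszKernel s x y) :
    ∫⁻ ω, rieszEnergy α (p⁻¹ • lam.restrict (Prod.mk ω ⁻¹' C)) ∂P ≤
      c₃ * rieszEnergy (α + s) lam := by
  simp_rw [rieszEnergy_smul_restrict]
  have hw : Measurable fun q : X × X ↦ rieszKernel α q.1 q.2 := measurable_rieszKernel_uncurry α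
  rw [lintegral_const_mul _ (measurable_setLIntegral_setLIntegral_section hC hw),
    lintegral_setLIntegral_setLIntegral_section hC hw]
  calc p⁻¹ * p⁻¹ * ∫⁻ q, (fun q : X × X ↦ rieszKernel α q.1 q.2) q * P (pairSet C q.1 q.2) ∂(lam.prod lam)
      ≤ p⁻¹ * p⁻¹ * ∫⁻ q, rieszKernel α q.1 q.2 * (c₃ * p ^ 2 * rieszKernel s q.1 q.2) ∂(lam.prod lam) := by
        gcongr p⁻¹ * p⁻¹ * ?_
        refine lintegral_mono_ae ?_
        filter_upwards [ae_prod_mem_mem hlamK] with q hq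
        exact mul_le_mul' le_rfl (h3 q.1 hq.1 q.2 hq.2)
    _ = p⁻¹ * p⁻¹ * ∫⁻ q, c₃ * p ^ 2 * rieszKernel (α + s) q.1 q.2 ∂(lam.prod lam) := by
        congr 1
        refine lintegral_congr fun q ↦ ?_
        rw [← rieszKernel_mul_rieszKernel hα hs]
        ring
    _ = c₃ * rieszEnergy (α + s) lam := by
        rw [lintegral_const_mul _ (measurable_rieszKernel_uncurry (α + s)), rieszEnergy_eq_lintegral_prod,
          ← mul_assoc, ← sq, ← mul_assoc, mul_comm (p⁻¹ ^ 2) c₃, mul_assoc c₃, ← ENNReal.inv_pow,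
          ENNReal.inv_mul_cancel (pow_ne_zero 2 hp0) (ENNReal.pow_ne_top hpt), mul_one]

omit [MetricSpace X] [BorelSpace X] [SecondCountableTopology X] in
/-- The mass `ω ↦ p⁻¹ λ(C_ω)` is measurable. [folklore] -/
theorem measurable_mass (hC : MeasurableSet C) (p : ℝ≥0∞) :
    Measurable fun ω ↦ p⁻¹ * lam (Prod.mk ω ⁻¹' C) :=
  (measurable_measure_prodMk_left hC).const_mul _

/-- The energy `ω ↦ I_α(μ_ω)` is measurable. [folklore] -/
theorem measurable_rieszEnergy_section (hC : MeasurableSet C) (p : ℝ≥0∞) (α : ℝ) :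
    Measurable fun ω ↦ rieszEnergy α (p⁻¹ • lam.restrict (Prod.mk ω ⁻¹' C)) := by
  simp_rw [rieszEnergy_smul_restrict]
  exact (measurable_setLIntegral_setLIntegral_section hC (measurable_rieszKernel_uncurry α)).const_mul _

end Moments

/-! ### A lower bound for the probability of a limsup -/

omit [MetricSpace X] [MeasurableSpace X] [BorelSpace X] [SecondCountableTopology X] in
/-- If every `Eₙ` has probability `≥ q`, so has `limsup Eₙ = ⋂ₘ ⋃_{n ≥ m} Eₙ` (continuity of the
finite measure `P` along the decreasing unions). [folklore] -/
theorem le_measure_limsup [IsFiniteMeasure P] {E : ℕ → Set Ω} (hE : ∀ n, MeasurableSet (E n))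
    {q : ℝ≥0∞} (h : ∀ n, q ≤ P (E n)) :
    q ≤ P (⋂ m, ⋃ n, ⋃ (_ : m ≤ n), E n) := by
  set B : ℕ → Set Ω := fun m ↦ ⋃ n, ⋃ (_ : m ≤ n), E n with hB
  have hBm : ∀ m, NullMeasurableSet (B m) P := fun m ↦
    (MeasurableSet.iUnion fun n ↦ MeasurableSet.iUnion fun _ ↦ hE n).nullMeasurableSet
  have hBanti : Antitone B := fun m m' hmm' ↦
    iUnion_mono fun n ↦ iUnion_subset fun hn ↦ subset_iUnion (fun _ : m ≤ n ↦ E n) (hmm'.trans hn)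
  have hBge : ∀ m, q ≤ P (B m) := fun m ↦
    (h m).trans (measure_mono (subset_iUnion_of_subset m
      (subset_iUnion (fun _ : m ≤ m ↦ E m) le_rfl)))
  have ht := tendsto_measure_iInter_atTop hBm hBanti ⟨0, measure_ne_top P _⟩
  exact ge_of_tendsto' ht hBge


/-! ### Beffara's Proposition 1 (2): the lower bound with positive probability -/

/-- **The second moment method for the dimension of a random limit set** (V. Beffara, *The
dimension of the SLE curves*, Ann. Probab. 36 (2008), Prop. 1 (2); *Hausdorff dimensions for
SLE₆*, Ann. Probab. 32 (2004), Prop. 1 (ii); detailed proof in Beffara, Ann. Inst. Fourier 53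
(2003), Thm. 2; the continuous version of Lawler's lemma, G. F. Lawler, in *Random walks
(Budapest, 1998)*, Bolyai Soc. Math. Stud. 9 (1999)), in the following abstract form. Let
`(C n)ₙ` be jointly measurable random subsets of a metric space `X`, almost surely closed,
contained in a fixed compact set `K` and decreasing in `n`; let `λ ≠ 0` be a finite reference
measure carried by `K` (`λ(Kᶜ) = 0`) whose Riesz energies `I_β(λ)` are finite for `0 < β < d`
(for the Lebesgue measure on the unit square, `d = 2`); and assume and that for some `s ∈ [0, d)`, scales `pₙ ∈ (0, ∞)` and
constants `c₁ > 0`, `c₃ < ∞`: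

1. (first moment, lower half of Beffara's condition 1) `P(x ∈ Cₙ) ≥ c₁ pₙ` for `x ∈ K`;
3. (second moment, Beffara's condition 3) `P(x, y ∈ Cₙ) ≤ c₃ pₙ² d(x, y)^{-s}` for `x, y ∈ K`.

Then **with positive probability `dim_H ⋂ₙ Cₙ(ω) ≥ d - s`**: there is an event `E` of positive
probability on which this holds. (Beffara's condition 2 and the upper half of condition 1 are
only needed for the almost sure upper bound, Prop. 1 (1), not treated here; `pₙ = εₙ^s` in the
paper.)

Proof: for the random measures `μₙ = pₙ⁻¹ λ|_{Cₙ}`, Tonelli gives `E μₙ(X) ≥ c₁ λ(X)`,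
`E μₙ(X)² ≤ c₃ I_s(λ)` and `E I_α(μₙ) ≤ c₃ I_{α+s}(λ)`; by Paley–Zygmund and Markov, with
probability `≥ q > 0` (independent of `n` and `α`) `μₙ` has mass `≥ a` and energy `≤ L_α`, in
which case every cover of `Cₙ` by balls has `∑ rᵢ^α ≥ c_α > 0`
(`le_ballContent_of_rieszEnergy_le`); on the limsup of these events (probability `≥ q`) this
holds for infinitely many, hence (monotonicity) all `n`, and passes to the compact decreasing
intersection (`le_ballContent_iInter`), giving `dim_H ⋂ Cₙ ≥ α`; finally `α ↑ d - s` along a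
sequence, again through a limsup of events of probability `≥ q`.
[cite: Beffara2008, Prop. 1 (2)] -/
theorem exists_measurableSet_le_dimH_iInter [IsProbabilityMeasure P] [Nonempty X] {K : Set X}
    (hK : IsCompact K) {lam : Measure X} [IsFiniteMeasure lam] (hlam : lam ≠ 0) (hlamK : lam Kᶜ = 0)
    {C : ℕ → Set (Ω × X)} (hCm : ∀ n, MeasurableSet (C n))
    (hreg : ∀ᵐ ω ∂P, (∀ n, IsClosed (Prod.mk ω ⁻¹' C n) ∧ Prod.mk ω ⁻¹' C n ⊆ K) ∧
      Antitone fun n ↦ Prod.mk ω ⁻¹' C n)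
    {s d : ℝ} (hs : 0 ≤ s) (hsd : s < d)
    (hfin : ∀ β : ℝ, 0 < β → β < d → rieszEnergy β lam ≠ ⊤)
    {p : ℕ → ℝ≥0∞} (hp0 : ∀ n, p n ≠ 0) (hpt : ∀ n, p n ≠ ⊤)
    {c₁ c₃ : ℝ≥0∞} (hc₁ : c₁ ≠ 0) (hc₃ : c₃ ≠ ⊤)
    (h1 : ∀ n, ∀ x ∈ K, c₁ * p n ≤ P {ω | (ω, x) ∈ C n})
    (h3 : ∀ n, ∀ x ∈ K, ∀ y ∈ K, P (pairSet (C n) x y) ≤ c₃ * p n ^ 2 * rieszKernel s x y) :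
    ∃ E : Set Ω, MeasurableSet E ∧ 0 < P E ∧
      ∀ ω ∈ E, ENNReal.ofReal (d - s) ≤ dimH (⋂ n, Prod.mk ω ⁻¹' C n) := by
  classical
  /- finite energies -/
  have hIs : rieszEnergy s lam ≠ ⊤ := by
    rcases hs.eq_or_lt with h | h
    · rw [← h, rieszEnergy_zero]
      exact ENNReal.mul_ne_top (measure_ne_top _ _) (measure_ne_top _ _)
    · exact hfin s h hsd
  /- constants -/
  have hlamu : lam univ ≠ 0 := by rwa [Ne, measure_univ_eq_zero]
  set c₁' : ℝ≥0∞ := min c₁ 1 with hc₁'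
  have hc₁'0 : c₁' ≠ 0 := (lt_min (pos_iff_ne_zero.2 hc₁) one_pos).ne'
  have hc₁'t : c₁' ≠ ⊤ := ne_top_of_le_ne_top ENNReal.one_ne_top (min_le_right _ _)
  have h1' : ∀ n, ∀ x ∈ K, c₁' * p n ≤ P {ω | (ω, x) ∈ C n} := fun n x hx ↦
    (mul_le_mul' (min_le_left _ _) le_rfl).trans (h1 n x hx)
  have hKm : MeasurableSet K := hK.measurableSet
  set e₀ : ℝ≥0∞ := c₁' * lam univ with he₀
  have he₀0 : e₀ ≠ 0 := mul_ne_zero hc₁'0 hlamu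
  have he₀t : e₀ ≠ ⊤ := ENNReal.mul_ne_top hc₁'t (measure_ne_top _ _)
  set a : ℝ≥0∞ := e₀ / 2 with ha
  have ha0 : a ≠ 0 := (ENNReal.div_pos he₀0 ENNReal.ofNat_ne_top).ne'
  have hat : a ≠ ⊤ := ENNReal.div_ne_top he₀t two_ne_zero
  set q₀ : ℝ≥0∞ := min (a ^ 2 / (c₃ * rieszEnergy s lam)) 1 with hq₀
  have hq₀0 : q₀ ≠ 0 :=
    (lt_min (ENNReal.div_pos (pow_ne_zero 2 ha0) (ENNReal.mul_ne_top hc₃ hIs)) one_pos).ne'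
  have hq₀t : q₀ ≠ ⊤ := ne_top_of_le_ne_top ENNReal.one_ne_top (min_le_right _ _)
  /- the random measures and their functionals -/
  set m : ℕ → Ω → ℝ≥0∞ := fun n ω ↦ (p n)⁻¹ * lam (Prod.mk ω ⁻¹' C n) with hm
  set I : ℝ → ℕ → Ω → ℝ≥0∞ := fun α n ω ↦
    rieszEnergy α ((p n)⁻¹ • lam.restrict (Prod.mk ω ⁻¹' C n)) with hI
  have hm_meas : ∀ n, Measurable (m n) := fun n ↦ measurable_mass (hCm n) (p n)
  have hI_meas : ∀ α n, Measurable (I α n) := fun α n ↦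
    measurable_rieszEnergy_section (hCm n) (p n) α
  /- Step 1 (Paley–Zygmund): `P(a < mₙ) ≥ q₀` -/
  have hPZ : ∀ n, q₀ ≤ P {ω | a < m n ω} := by
    intro n
    have hE1 : e₀ ≤ ∫⁻ ω, m n ω ∂P := le_lintegral_mass (hCm n) hKm hlamK (hp0 n) (hpt n) (h1' n)
    have hE2 : ∫⁻ ω, m n ω ^ 2 ∂P ≤ c₃ * rieszEnergy s lam :=
      lintegral_mass_sq_le (hCm n) hlamK (hp0 n) (hpt n) (h3 n)
    calc q₀ ≤ a ^ 2 / (c₃ * rieszEnergy s lam) := min_le_left _ _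
      _ ≤ (∫⁻ ω, m n ω ∂P - a) ^ 2 / ∫⁻ ω, m n ω ^ 2 ∂P := by
          refine ENNReal.div_le_div ?_ hE2
          gcongr
          refine ENNReal.le_sub_of_add_le_right hat ?_
          calc a + a = e₀ := by rw [ha, ENNReal.add_halves]
            _ ≤ ∫⁻ ω, m n ω ∂P := hE1
      _ ≤ P {ω | a < m n ω} := paleyZygmund_div_le (hm_meas n).aemeasurable a
  /- Step 2: for `0 < α < d - s`, energy levels, good events, contents -/
  set EL : ℝ → ℝ≥0∞ := fun α ↦ c₃ * rieszEnergy (α + s) lam + 1 with hEL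
  set L : ℝ → ℝ≥0∞ := fun α ↦ 2 * EL α / q₀ with hL
  set Good : ℝ → ℕ → Set Ω := fun α n ↦ {ω | a < m n ω} ∩ {ω | I α n ω < L α} with hGood
  have hGood_meas : ∀ α n, MeasurableSet (Good α n) := fun α n ↦
    (measurableSet_lt measurable_const (hm_meas n)).inter
      (measurableSet_lt (hI_meas α n) measurable_const)
  set F : ℝ → Set Ω := fun α ↦ ⋂ j, ⋃ n, ⋃ (_ : j ≤ n), Good α n with hF
  have hF_meas : ∀ α, MeasurableSet (F α) := fun α ↦
    MeasurableSet.iInter fun j ↦ MeasurableSet.iUnion fun n ↦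
      MeasurableSet.iUnion fun _ ↦ hGood_meas α n
  -- the regular sample points
  obtain ⟨R, hRm, hR0, hR⟩ : ∃ R : Set Ω, MeasurableSet R ∧ P Rᶜ = 0 ∧
      ∀ ω ∈ R, (∀ n, IsClosed (Prod.mk ω ⁻¹' C n) ∧ Prod.mk ω ⁻¹' C n ⊆ K) ∧
        Antitone fun n ↦ Prod.mk ω ⁻¹' C n := by
    rw [ae_iff] at hreg
    obtain ⟨N, hNsup, hNm, hN0⟩ := exists_measurable_superset_of_null hreg
    refine ⟨Nᶜ, hNm.compl, by rwa [compl_compl], fun ω hω ↦ ?_⟩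
    by_contra h
    exact hω (hNsup h)
  have key : ∀ α : ℝ, 0 < α → α + s < d →
      q₀ / 2 ≤ P (F α) ∧ ∀ ω ∈ F α ∩ R, ENNReal.ofReal α ≤ dimH (⋂ n, Prod.mk ω ⁻¹' C n) := by
    intro α hα hαs
    have hELt : EL α ≠ ⊤ := by
      simp only [hEL]
      exact ENNReal.add_ne_top.2
        ⟨ENNReal.mul_ne_top hc₃ (hfin _ (by linarith) hαs), ENNReal.one_ne_top⟩
    have hEL0 : EL α ≠ 0 := by simp [hEL]
    have hLt : L α ≠ ⊤ := ENNReal.div_ne_top (ENNReal.mul_ne_top ENNReal.ofNat_ne_top hELt) hq₀0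
    have hL0 : L α ≠ 0 := (ENNReal.div_pos (mul_ne_zero two_ne_zero hEL0) hq₀t).ne'
    -- Markov
    have hMarkov : ∀ n, P {ω | L α ≤ I α n ω} ≤ q₀ / 2 := by
      intro n
      have hEI : ∫⁻ ω, I α n ω ∂P ≤ EL α :=
        (lintegral_rieszEnergy_le (hCm n) hlamK (hp0 n) (hpt n) hs hα.le (h3 n)).trans le_self_add
      calc P {ω | L α ≤ I α n ω} ≤ (∫⁻ ω, I α n ω ∂P) / L α :=
            meas_ge_le_lintegral_div (hI_meas α n).aemeasurable hL0 hLt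
        _ ≤ EL α / L α := by gcongr
        _ ≤ q₀ / 2 := by
            refine ENNReal.div_le_of_le_mul ?_
            have hcalc : q₀ / 2 * L α = EL α := by
              simp only [hL, div_eq_mul_inv]
              calc q₀ * 2⁻¹ * (2 * EL α * q₀⁻¹) = (q₀ * q₀⁻¹) * (2⁻¹ * 2) * EL α := by ring
                _ = EL α := by
                  rw [ENNReal.mul_inv_cancel hq₀0 hq₀t, ENNReal.inv_mul_cancel two_ne_zero
                    ENNReal.ofNat_ne_top, one_mul, one_mul]
            rw [hcalc]
    -- the good events have probability `≥ q₀ / 2`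
    have hGoodP : ∀ n, q₀ / 2 ≤ P (Good α n) := by
      intro n
      have hsub : {ω | a < m n ω} ⊆ Good α n ∪ {ω | L α ≤ I α n ω} := fun ω hω ↦ by
        by_cases h : I α n ω < L α
        · exact Or.inl ⟨hω, h⟩
        · exact Or.inr (not_lt.1 h)
      have h1 : q₀ ≤ P (Good α n) + q₀ / 2 :=
        calc q₀ ≤ P {ω | a < m n ω} := hPZ n
          _ ≤ P (Good α n) + P {ω | L α ≤ I α n ω} :=
              (measure_mono hsub).trans (measure_union_le _ _)
          _ ≤ P (Good α n) + q₀ / 2 := by gcongr; exact hMarkov n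
      calc q₀ / 2 = q₀ - q₀ / 2 := (ENNReal.sub_half hq₀t).symm
        _ ≤ P (Good α n) := tsub_le_iff_right.2 h1
    refine ⟨le_measure_limsup (hGood_meas α) hGoodP, fun ω ⟨hωF, hωR⟩ ↦ ?_⟩
    -- contents on the good events
    set cα : ℝ≥0∞ := contentConst α a (L α) with hcα
    have hcα0 : 0 < cα := contentConst_pos α ha0 hat hLt
    have hcontent : ∀ n, ω ∈ Good α n → cα ≤ ballContent α (Prod.mk ω ⁻¹' C n) := by
      intro n ⟨hωm, hωI⟩
      have hA : MeasurableSet (Prod.mk ω ⁻¹' C n) := measurable_prodMk_left (hCm n)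
      set μ : Measure X := (p n)⁻¹ • lam.restrict (Prod.mk ω ⁻¹' C n) with hμ
      haveI : IsFiniteMeasure μ := ⟨by
        rw [hμ, Measure.smul_apply, smul_eq_mul, Measure.restrict_apply_univ]
        exact ENNReal.mul_lt_top (ENNReal.inv_ne_top.2 (hp0 n)).lt_top (measure_lt_top _ _)⟩
      have hmass : a ≤ μ univ := by
        rw [hμ, Measure.smul_apply, smul_eq_mul, Measure.restrict_apply_univ]
        exact hωm.le
      have hsupp : μ (Prod.mk ω ⁻¹' C n)ᶜ = 0 := by
        rw [hμ, Measure.smul_apply, smul_eq_mul, Measure.restrict_apply hA.compl,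
          compl_inter_self, measure_empty, mul_zero]
      exact le_ballContent_of_rieszEnergy_le hα ha0 hmass hLt hωI.le hsupp
    -- on `F α ∩ R`: every section has content `≥ cα`, and so has the intersection
    obtain ⟨hclosed, hanti⟩ := hR ω hωR
    have hall : ∀ j, cα ≤ ballContent α (Prod.mk ω ⁻¹' C j) := by
      intro j
      have hωj : ω ∈ ⋃ n, ⋃ (_ : j ≤ n), Good α n := mem_iInter.1 hωF j
      obtain ⟨n, hn⟩ := mem_iUnion.1 hωj
      obtain ⟨hjn, hωn⟩ := mem_iUnion.1 hn
      exact (hcontent n hωn).trans (ballContent_mono (hanti hjn))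
    have hinter : cα ≤ ballContent α (⋂ n, Prod.mk ω ⁻¹' C n) :=
      le_ballContent_iInter (fun n ↦ hK.of_isClosed_subset (hclosed n).1 (hclosed n).2) hanti hall
    exact le_dimH_of_ballContent_pos hα (hcα0.trans_le hinter)
  /- Step 3: `α ↑ d - s` along a sequence -/
  set αk : ℕ → ℝ := fun k ↦ (d - s) * (1 - 1 / ((k : ℝ) + 2)) with hαk
  have hds : 0 < d - s := sub_pos.2 hsd
  have hfrac : ∀ k : ℕ, 0 < 1 / ((k : ℝ) + 2) ∧ 1 / ((k : ℝ) + 2) ≤ 1 / 2 := fun k ↦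
    ⟨by positivity, one_div_le_one_div_of_le two_pos (by linarith [(Nat.cast_nonneg k : (0 : ℝ) ≤ k)])⟩
  have hαk_pos : ∀ k, 0 < αk k := fun k ↦ by
    have := (hfrac k).2
    simp only [hαk]
    exact mul_pos hds (by linarith)
  have hαk_lt : ∀ k, αk k + s < d := fun k ↦ by
    have := (hfrac k).1
    have h : αk k < d - s := by
      simp only [hαk]
      exact mul_lt_of_lt_one_right hds (by linarith)
    linarith
  have hαk_tendsto : Tendsto (fun k ↦ ENNReal.ofReal (αk k)) atTop
      (𝓝 (ENNReal.ofReal (d - s))) := by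
    refine ENNReal.tendsto_ofReal ?_
    have h1 : Tendsto (fun k : ℕ ↦ 1 / ((k : ℝ) + 2)) atTop (𝓝 0) := by
      have := (tendsto_one_div_add_atTop_nhds_zero_nat (𝕜 := ℝ)).comp (tendsto_add_atTop_nat 1)
      refine this.congr fun k ↦ ?_
      simp only [Function.comp_apply, Nat.cast_add, Nat.cast_one]
      ring_nf
    have h2 : Tendsto (fun k : ℕ ↦ (d - s) * (1 - 1 / ((k : ℝ) + 2))) atTop
        (𝓝 ((d - s) * (1 - 0))) :=
      (tendsto_const_nhds.sub h1).const_mul (d - s)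
    rw [sub_zero, mul_one] at h2
    exact h2
  /- the final event -/
  set G : Set Ω := ⋂ j, ⋃ k, ⋃ (_ : j ≤ k), F (αk k) with hG
  have hGm : MeasurableSet G := MeasurableSet.iInter fun j ↦ MeasurableSet.iUnion fun k ↦
    MeasurableSet.iUnion fun _ ↦ hF_meas _
  have hGP : q₀ / 2 ≤ P G :=
    le_measure_limsup (fun k ↦ hF_meas (αk k)) fun k ↦ (key (αk k) (hαk_pos k) (hαk_lt k)).1
  refine ⟨G ∩ R, hGm.inter hRm, ?_, fun ω ⟨hωG, hωR⟩ ↦ ?_⟩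
  · rw [measure_inter_conull hR0]
    exact lt_of_lt_of_le (ENNReal.div_pos hq₀0 ENNReal.ofNat_ne_top) hGP
  · refine le_of_forall_lt fun c hc ↦ ?_
    have hev : ∀ᶠ k in atTop, c < ENNReal.ofReal (αk k) := hαk_tendsto.eventually_const_lt hc
    obtain ⟨j, hj⟩ := eventually_atTop.1 hev
    have hωj : ω ∈ ⋃ k, ⋃ (_ : j ≤ k), F (αk k) := mem_iInter.1 hωG j
    obtain ⟨k, hk⟩ := mem_iUnion.1 hωj
    obtain ⟨hjk, hωk⟩ := mem_iUnion.1 hk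
    exact (hj k hjk).trans_le ((key (αk k) (hαk_pos k) (hαk_lt k)).2 ω ⟨hωk, hωR⟩)

/-- **Beffara's Proposition 1 (2), outer-measure form**: under the hypotheses of
`exists_measurableSet_le_dimH_iInter`, `P(dim_H ⋂ₙ Cₙ ≥ d - s) > 0` (for the outer measure
`P` of the possibly non-measurable event). [cite: Beffara2008, Prop. 1 (2)] -/
theorem measure_le_dimH_iInter_pos [IsProbabilityMeasure P] [Nonempty X] {K : Set X}
    (hK : IsCompact K) {lam : Measure X} [IsFiniteMeasure lam] (hlam : lam ≠ 0) (hlamK : lam Kᶜ = 0)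
    {C : ℕ → Set (Ω × X)} (hCm : ∀ n, MeasurableSet (C n))
    (hreg : ∀ᵐ ω ∂P, (∀ n, IsClosed (Prod.mk ω ⁻¹' C n) ∧ Prod.mk ω ⁻¹' C n ⊆ K) ∧
      Antitone fun n ↦ Prod.mk ω ⁻¹' C n)
    {s d : ℝ} (hs : 0 ≤ s) (hsd : s < d)
    (hfin : ∀ β : ℝ, 0 < β → β < d → rieszEnergy β lam ≠ ⊤)
    {p : ℕ → ℝ≥0∞} (hp0 : ∀ n, p n ≠ 0) (hpt : ∀ n, p n ≠ ⊤)
    {c₁ c₃ : ℝ≥0∞} (hc₁ : c₁ ≠ 0) (hc₃ : c₃ ≠ ⊤)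
    (h1 : ∀ n, ∀ x ∈ K, c₁ * p n ≤ P {ω | (ω, x) ∈ C n})
    (h3 : ∀ n, ∀ x ∈ K, ∀ y ∈ K, P (pairSet (C n) x y) ≤ c₃ * p n ^ 2 * rieszKernel s x y) :
    0 < P {ω | ENNReal.ofReal (d - s) ≤ dimH (⋂ n, Prod.mk ω ⁻¹' C n)} := by
  obtain ⟨E, -, hE, hdim⟩ := exists_measurableSet_le_dimH_iInter hK hlam hlamK hCm hreg hs hsd hfin
    hp0 hpt hc₁ hc₃ h1 h3
  exact hE.trans_le (measure_mono fun ω hω ↦ hdim ω hω)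

end Literature.Probability.RandomFractals

end
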